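import Literature.Algebra.Homology.LaurentCechFreeCohomology
import Literature.Algebra.Homology.OrderedCechMap
import Mathlib.RingTheory.Polynomial.Basic
import Mathlib.RingTheory.Noetherian.Basic
import HarnessLib

/-!
# Graded submodules of free modules over `A[x₀, …, x_r]`: presentations and the short exact sequence of Čech complexes

Continuation of `Literature/Algebra/Homology/LaurentCech` (`P = A[x₀, …, x_r]`, `L` the Laurent
polynomials, `F_e = ⊕_{j ∈ J} P(-e_j) ⊆ L^J`). This file supplies the two inputs of the induction step of
Serre's finiteness theorem (Hartshorne, *Algebraic Geometry*, III Thm. 5.2 (a), proof: "`𝓕` is a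
quotient of a sheaf `𝓔 = ⊕ 𝒪(q_i)` … `0 → 𝓡 → 𝓔 → 𝓕 → 0` … long exact sequence"):

* gradings: `LaurentCech.projDeg e dd` (homogeneous components of vectors of polynomials for the
  shifted grading, via Mathlib `MvPolynomial.homogeneousComponent`), `KfilterDeg` (degree filters on
  `L^J`) with `ιK_projDeg` (`ι` intertwines them), `sum_projDeg` (a vector is the sum of its
  homogeneous components), `LaurentCech.IsGraded e K` (graded submodule), `LaurentCech.IsDegZero`
  (degree-zero `P`-linear maps of free modules; their kernels and images are graded);
* `LaurentCech.exists_presentation` — **for `A` Noetherian every graded `K ⊆ P^J` is the image of a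
  degree-zero `P`-linear `φ : ⊕_{h < N} P(-e'_h) → P^J`** (homogeneous components of finitely many
  generators; `P` is Noetherian by Hilbert's basis theorem, Mathlib `MvPolynomial.isNoetherianRing`);
* `LaurentCech.extL φ` — the `L`-linear extension `φ_L : L^{N} → L^J`, with `extL_ιK`
  (`φ_L ∘ ι = ι ∘ φ`), and the exactness of localization made explicit: `extL_surjOn`
  (**`φ_L` maps `(P^N_s)_{dd}` onto `(K_s)_{dd}`**, lifting `x_s^M v = ι(φ u)` by the homogeneous
  component of `u`) and `mem_locDeg_ker_of_extL_eq_zero` (its kernel there is `((ker φ)_s)_{dd}`);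
* `LaurentCech.presentationSC`, `LaurentCech.shortExact_presentationSC` — **the short exact sequence of
  Čech complexes `0 → Č_{dd}(ker φ) → Č_{dd}(P^N) → Č_{dd}(im φ) → 0`** (via
  `Literature/Algebra/Homology/OrderedCechMap`), i.e. Stacks Project, Tag 01EV / Hartshorne III.5 for
  the sequence of graded modules `0 → ker φ → P^N → K → 0` and the standard affine cover of `𝐏^r_A`.

Everything is proved. Mathlib searched (pin v4.32): `MvPolynomial.homogeneousComponent`,
`MvPolynomial.isNoetherianRing`, `isNoetherian_pi`, `Submodule.FG`, `LinearMap.smulRight` (used); no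
graded presentations / graded Nakayama-type API for `MvPolynomial`-modules.

## References

* R. Hartshorne, *Algebraic Geometry*, GTM 52, Springer (1977): III Thm. 5.2 (a) and its proof,
  II Cor. 5.18 (p. 121, quotients of `⊕ 𝒪(q_i)`). [Hartshorne1977]
* The Stacks Project, Tag 01EV (short exact sequences of Čech complexes); Cohomology of Schemes,
  Lemma `coherent-projective` (proof).
  [StacksProject]
-/

noncomputable section

open Finset AddMonoidAlgebra CategoryTheory

universe u

namespace Literature.Algebra.Homology

namespace LaurentCech

open OrderedCech

variable {A : Type u} [CommRing A] {r : ℕ} {J : Type}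

/-! ### Degree filters on `L^n` -/

/-- A Laurent polynomial is the sum of its monomials. [folklore] -/
theorem eq_sum_single (x : L A r) :
    x = ∑ m ∈ x.coeff.support, AddMonoidAlgebra.single m (x.coeff m) := by
  conv_lhs => rw [← AddMonoidAlgebra.sum_coeff_single x]
  rfl

/-- Filtering by degree a Laurent polynomial of that degree does nothing. [folklore] -/
theorem Lfilter_edeg_of_mem {c : ℤ} {x : L A r} (hx : x ∈ Ldeg A r c) :
    Lfilter (fun m => edeg r m = c) x = x := by
  refine AddMonoidAlgebra.ext (Finsupp.ext fun m => ?_)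
  rw [coeff_Lfilter]
  split_ifs with h
  · rfl
  · rw [mem_Ldeg] at hx
    by_contra hne
    exact h (hx m (Ne.symm hne))

/-- Filtering by degree `k` a Laurent polynomial of another degree gives zero. [folklore] -/
theorem Lfilter_edeg_of_mem_ne {c k : ℤ} {x : L A r} (hx : x ∈ Ldeg A r c) (hk : k ≠ c) :
    Lfilter (fun m => edeg r m = k) x = 0 := by
  refine AddMonoidAlgebra.ext (Finsupp.ext fun m => ?_)
  rw [coeff_Lfilter]
  split_ifs with h
  · rw [mem_Ldeg] at hx
    by_contra hne
    exact hk (h.symm.trans (hx m hne))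
  · rfl

/-- **Degree filters and products**: for `y ∈ L_{c}`, the degree-`k` part of `x y` is the
degree-`(k - c)` part of `x` times `y`. [folklore] -/
theorem Lfilter_edeg_mul_of_mem {c k : ℤ} (x : L A r) {y : L A r} (hy : y ∈ Ldeg A r c) :
    Lfilter (fun m => edeg r m = k) (x * y) = Lfilter (fun m => edeg r m = k - c) x * y := by
  rw [eq_sum_single x, Finset.sum_mul, map_sum, map_sum, Finset.sum_mul]
  refine Finset.sum_congr rfl fun m _ => ?_
  have hprod : AddMonoidAlgebra.single m (x.coeff m) * y ∈ Ldeg A r (edeg r m + c) :=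
    single_mul_mem_Ldeg rfl _ hy
  have hsingle : AddMonoidAlgebra.single m (x.coeff m) ∈ Ldeg A r (edeg r m) := single_mem_Ldeg rfl _
  by_cases h : edeg r m + c = k
  · rw [Lfilter_edeg_of_mem (h ▸ hprod), Lfilter_edeg_of_mem ((show edeg r m = k - c by omega) ▸ hsingle)]
  · rw [Lfilter_edeg_of_mem_ne hprod (Ne.symm h), Lfilter_edeg_of_mem_ne hsingle (by omega), zero_mul]

variable (e : J → ℤ)

/-- The degree-`dd` part of a vector of `L^n` for the grading shifted by `e` (coordinate `j` is
filtered in degree `dd - e_j`), an `A`-linear projection onto `𝕂_{dd}`. [folklore] -/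
def KfilterDeg (dd : ℤ) : (J → L A r) →ₗ[A] (J → L A r) :=
  LinearMap.pi fun j => (Lfilter fun m => edeg r m = dd - e j) ∘ₗ LinearMap.proj j

/-- Coefficients of `KfilterDeg`. [folklore] -/
@[simp] theorem coeff_KfilterDeg (dd : ℤ) (v : J → L A r) (j : J) (m : Expt r) :
    ((KfilterDeg e dd v) j).coeff m = if edeg r m = dd - e j then (v j).coeff m else 0 := by
  simp [KfilterDeg]

/-- `KfilterDeg e dd v ∈ 𝕂_{dd}`. [folklore] -/
theorem KfilterDeg_mem_Kdeg (dd : ℤ) (v : J → L A r) : KfilterDeg e dd v ∈ Kdeg A r e dd := by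
  rw [mem_Kdeg]
  intro j
  rw [mem_Ldeg]
  intro m hm
  rw [coeff_KfilterDeg] at hm
  split_ifs at hm with h
  · exact h
  · exact absurd rfl hm

/-- `KfilterDeg e dd` is the identity on `𝕂_{dd}`. [folklore] -/
theorem KfilterDeg_of_mem {dd : ℤ} {v : J → L A r} (hv : v ∈ Kdeg A r e dd) : KfilterDeg e dd v = v := by
  rw [mem_Kdeg] at hv
  funext j
  exact Lfilter_edeg_of_mem (hv j)

/-- `KfilterDeg e k` kills `𝕂_{dd}` for `k ≠ dd`. [folklore] -/
theorem KfilterDeg_of_mem_ne {dd k : ℤ} {v : J → L A r} (hv : v ∈ Kdeg A r e dd) (hk : k ≠ dd) :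
    KfilterDeg e k v = 0 := by
  rw [mem_Kdeg] at hv
  funext j
  exact Lfilter_edeg_of_mem_ne (hv j) (by omega)

/-- A vector lies in `𝕂_{dd}` iff it is fixed by the degree-`dd` filter. [folklore] -/
theorem mem_Kdeg_iff_KfilterDeg_eq {dd : ℤ} {v : J → L A r} :
    v ∈ Kdeg A r e dd ↔ KfilterDeg e dd v = v :=
  ⟨KfilterDeg_of_mem e, fun h => h ▸ KfilterDeg_mem_Kdeg e dd v⟩

/-- Degree filters and the action of `L`: for `x ∈ 𝕂_c`, `(l · x)_{dd} = l_{dd - c} · x`. [folklore] -/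
theorem KfilterDeg_smul_of_mem {c dd : ℤ} (l : L A r) {x : J → L A r} (hx : x ∈ Kdeg A r e c) :
    KfilterDeg e dd (l • x) = Lfilter (fun m => edeg r m = dd - c) l • x := by
  rw [mem_Kdeg] at hx
  funext j
  change Lfilter (fun m => edeg r m = dd - e j) (l * x j) = Lfilter (fun m => edeg r m = dd - c) l * x j
  rw [Lfilter_edeg_mul_of_mem l (hx j), show dd - e j - (c - e j) = dd - c by ring]

/-! ### Homogeneous components of vectors of polynomials -/

/-- The homogeneous component of integer degree `c` of a polynomial (zero for `c < 0`). [folklore] -/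
def hcomp (c : ℤ) : P A r →ₗ[A] P A r :=
  if 0 ≤ c then MvPolynomial.homogeneousComponent c.toNat else 0

/-- `toL` of a homogeneous component is the degree filter of `toL`. [folklore] -/
theorem toL_hcomp (c : ℤ) (p : P A r) : toL A r (hcomp c p) = Lfilter (fun m => edeg r m = c) (toL A r p) := by
  refine AddMonoidAlgebra.ext (Finsupp.ext fun m => ?_)
  rw [coeff_Lfilter]
  by_cases hneg : ∃ i, m i < 0
  · rw [coeff_toL_eq_zero _ hneg, coeff_toL_eq_zero _ hneg, ite_self]
  · push Not at hneg
    obtain ⟨m', rfl⟩ := (mem_range_castExp_iff r m).mpr hneg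
    rw [coeff_toL_castExp, coeff_toL_castExp, edeg_castExp, hcomp]
    split_ifs with hc h h
    · change MvPolynomial.coeff m' (MvPolynomial.homogeneousComponent c.toNat p) = _
      rw [MvPolynomial.coeff_homogeneousComponent, if_pos (by omega)]
    · change MvPolynomial.coeff m' (MvPolynomial.homogeneousComponent c.toNat p) = _
      rw [MvPolynomial.coeff_homogeneousComponent, if_neg (by omega)]
    · omega
    · rfl

/-- The degree-`dd` homogeneous component of a vector of polynomials for the grading shifted by `e`.
[folklore] -/
def projDeg (dd : ℤ) : (J → P A r) →ₗ[A] (J → P A r) :=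
  LinearMap.pi fun j => hcomp (dd - e j) ∘ₗ LinearMap.proj j

/-- `projDeg` unfolded. [folklore] -/
theorem projDeg_apply (dd : ℤ) (v : J → P A r) (j : J) : projDeg e dd v j = hcomp (dd - e j) (v j) := rfl

/-- **`ι` intertwines homogeneous components and degree filters.** [folklore] -/
theorem ιK_projDeg (dd : ℤ) (v : J → P A r) : ιK A r J (projDeg e dd v) = KfilterDeg e dd (ιK A r J v) := by
  funext j
  rw [ιK_apply, projDeg_apply, toL_hcomp]
  rfl

/-- A vector of polynomials is homogeneous of degree `dd` (fixed by `projDeg e dd`) iff its image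
lies in `𝕂_{dd}`. [folklore] -/
theorem projDeg_eq_self_iff {dd : ℤ} {v : J → P A r} : projDeg e dd v = v ↔ ιK A r J v ∈ Kdeg A r e dd := by
  rw [mem_Kdeg_iff_KfilterDeg_eq, ← ιK_projDeg]
  exact ⟨fun h => by rw [h], fun h => ιK_injective h⟩

/-- The (finite) set of degrees occurring in a vector of polynomials. [folklore] -/
def degSet [Fintype J] (v : J → P A r) : Finset ℤ :=
  Finset.univ.biUnion fun j => (v j).support.image fun m => (m.degree : ℤ) + e j

/-- Every monomial of `ι v` has its (shifted) degree in `degSet e v`. [folklore] -/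
theorem mem_degSet_of_coeff_ne_zero [Fintype J] (v : J → P A r) (j : J) {m : Expt r}
    (hm : ((ιK A r J v) j).coeff m ≠ 0) : edeg r m + e j ∈ degSet e v := by
  rw [ιK_apply] at hm
  by_cases hneg : ∃ i, m i < 0
  · exact absurd (coeff_toL_eq_zero _ hneg) hm
  · push Not at hneg
    obtain ⟨m', rfl⟩ := (mem_range_castExp_iff r m).mpr hneg
    rw [coeff_toL_castExp] at hm
    rw [degSet, Finset.mem_biUnion]
    refine ⟨j, Finset.mem_univ j, Finset.mem_image.mpr ⟨m', ?_, by rw [edeg_castExp]⟩⟩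
    exact MvPolynomial.mem_support_iff.mpr hm

/-- **A vector of polynomials is the sum of its homogeneous components.** [folklore] -/
theorem sum_projDeg [Fintype J] (v : J → P A r) : ∑ dd ∈ degSet e v, projDeg e dd v = v := by
  apply ιK_injective
  rw [map_sum]
  simp_rw [ιK_projDeg]
  funext j
  refine AddMonoidAlgebra.ext (Finsupp.ext fun m => ?_)
  rw [Finset.sum_apply, AddMonoidAlgebra.coeff_sum, Finset.sum_apply']
  simp_rw [coeff_KfilterDeg]
  simp_rw [show ∀ dd, (edeg r m = dd - e j) = (dd = edeg r m + e j) from fun dd => propext ⟨fun h => by omega, fun h => by omega⟩]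
  rw [Finset.sum_ite_eq']
  split_ifs with h
  · rfl
  · by_contra hne
    exact h (mem_degSet_of_coeff_ne_zero e v j (Ne.symm hne))

/-! ### Graded submodules -/

/-- A `P`-submodule `K ⊆ P^n` is *graded* (for the grading shifted by `e`) if it contains the
homogeneous components of its elements. [folklore] -/
def IsGraded (K : Submodule (P A r) (J → P A r)) : Prop :=
  ∀ (dd : ℤ), ∀ v ∈ K, projDeg e dd v ∈ K

/-- The whole free module is graded. [folklore] -/
theorem isGraded_top : IsGraded e (⊤ : Submodule (P A r) (J → P A r)) := fun _ _ _ => Submodule.mem_top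

variable {J' : Type} (e' : J' → ℤ)

/-- A `P`-linear map `φ : P^{n'} → P^n` is *graded of degree zero* if it commutes with taking
homogeneous components. [folklore] -/
def IsDegZero (φ : (J' → P A r) →ₗ[P A r] (J → P A r)) : Prop :=
  ∀ (dd : ℤ) (w : J' → P A r), φ (projDeg e' dd w) = projDeg e dd (φ w)

/-- The kernel of a degree-zero map is graded. [folklore] -/
theorem IsDegZero.isGraded_ker {φ : (J' → P A r) →ₗ[P A r] (J → P A r)} (hφ : IsDegZero e e' φ) :
    IsGraded e' (LinearMap.ker φ) := by
  intro dd w hw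
  rw [LinearMap.mem_ker] at hw ⊢
  rw [hφ, hw, map_zero]

/-- The range of a degree-zero map is graded. [folklore] -/
theorem IsDegZero.isGraded_range {φ : (J' → P A r) →ₗ[P A r] (J → P A r)} (hφ : IsDegZero e e' φ) :
    IsGraded e (LinearMap.range φ) := by
  rintro dd _ ⟨w, rfl⟩
  exact ⟨projDeg e' dd w, hφ dd w⟩

/-! ### Homogeneous vectors and degree-zero maps out of free modules -/

/-- A vector `v ∈ P^n` is homogeneous of degree `dd` (for the shift `e`) if `projDeg e dd v = v`.
[folklore] -/
def IsHomog (dd : ℤ) (v : J → P A r) : Prop := projDeg e dd v = v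

/-- The basis vector `e_h` of `P^{n'}` is homogeneous of degree `e'_h`. [folklore] -/
theorem isHomog_single [DecidableEq J'] (h : J') : IsHomog e' (e' h) (Pi.single h 1 : J' → P A r) := by
  rw [IsHomog, projDeg_eq_self_iff, mem_Kdeg]
  intro j
  rw [ιK_apply]
  by_cases hj : j = h
  · subst hj
    rw [Pi.single_eq_same, map_one, AddMonoidAlgebra.one_def]
    exact single_mem_Ldeg (by simp) 1
  · rw [Pi.single_eq_of_ne hj, map_zero]
    exact Submodule.zero_mem _

/-- Homogeneous components of `p • b` for `b` homogeneous of degree `c`: `(p b)_{dd} = p_{dd - c} b`.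
[folklore] -/
theorem projDeg_smul_of_isHomog {c : ℤ} {b : J → P A r} (hb : IsHomog e c b) (dd : ℤ) (p : P A r) :
    projDeg e dd (p • b) = hcomp (dd - c) p • b := by
  apply ιK_injective
  rw [ιK_projDeg, ιK_smul, ιK_smul, toL_hcomp]
  exact KfilterDeg_smul_of_mem e (toL A r p) ((projDeg_eq_self_iff e).mp hb)

/-- A `P`-linear map out of `P^{n'}` sending each basis vector `e_h` to a homogeneous vector of
degree `e'_h` is graded of degree zero. [folklore] -/
theorem isDegZero_of_isHomog [Fintype J'] [DecidableEq J'] (φ : (J' → P A r) →ₗ[P A r] (J → P A r))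
    (hφ : ∀ h, IsHomog e (e' h) (φ (Pi.single h 1))) : IsDegZero e e' φ := by
  intro dd w
  have hw : w = ∑ h, w h • (Pi.single h 1 : J' → P A r) := by
    conv_lhs => rw [← Finset.univ_sum_single w]
    refine Finset.sum_congr rfl fun h _ => ?_
    rw [← Pi.single_smul', smul_eq_mul, mul_one]
  conv_lhs => rw [hw, map_sum, map_sum]
  conv_rhs => rw [hw, map_sum, map_sum]
  refine Finset.sum_congr rfl fun h _ => ?_
  rw [projDeg_smul_of_isHomog e' (isHomog_single e' h), map_smul, map_smul,
    projDeg_smul_of_isHomog e (hφ h)]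

/-! ### Graded presentations of graded submodules (Noetherian base) -/

/-- **Graded submodules of `P^n` have finite graded presentations** when `A` is Noetherian: a graded
`K ⊆ P^n` is the image of a degree-zero `P`-linear map `φ : ⊕_{h} P(-e'_h) → P^n` out of a finite
free graded module (take homogeneous components of finitely many generators; `P = A[x₀, …, x_r]` is
Noetherian by Hilbert's basis theorem). [folklore] -/
theorem exists_presentation [Finite J] [IsNoetherianRing A] {K : Submodule (P A r) (J → P A r)}
    (hK : IsGraded e K) :
    ∃ (N : ℕ) (e' : Fin N → ℤ) (φ : (Fin N → P A r) →ₗ[P A r] (J → P A r)),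
      IsDegZero e e' φ ∧ LinearMap.range φ = K := by
  classical
  haveI := Fintype.ofFinite J
  haveI : IsNoetherianRing (P A r) := MvPolynomial.isNoetherianRing
  haveI : IsNoetherian (P A r) (J → P A r) := isNoetherian_pi
  obtain ⟨t, ht⟩ := (IsNoetherian.noetherian K : K.FG)
  -- index set: pairs (generator, one of its degrees), enumerated by `Fin N`
  let H : Finset ((J → P A r) × ℤ) := t.biUnion fun g => (degSet e g).image fun dd => (g, dd)
  let N := Fintype.card ↥H
  let ε : Fin N ≃ ↥H := (Fintype.equivFin ↥H).symm
  let b : Fin N → (J → P A r) := fun i => projDeg e (ε i).1.2 (ε i).1.1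
  have hbK : ∀ i, b i ∈ K := fun i => by
    have hg : (ε i).1.1 ∈ t := by
      obtain ⟨g, hg, hh⟩ := Finset.mem_biUnion.mp (ε i).2
      obtain ⟨dd, -, hdd⟩ := Finset.mem_image.mp hh
      rw [← hdd]; exact hg
    exact hK _ _ (ht ▸ Submodule.subset_span hg)
  have hbhom : ∀ i, IsHomog e (ε i).1.2 (b i) := fun i => by
    change projDeg e (ε i).1.2 (projDeg e (ε i).1.2 (ε i).1.1) = projDeg e (ε i).1.2 (ε i).1.1
    apply ιK_injective
    rw [ιK_projDeg, ιK_projDeg]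
    exact KfilterDeg_of_mem e (KfilterDeg_mem_Kdeg e _ _)
  let φ : (Fin N → P A r) →ₗ[P A r] (J → P A r) := ∑ i, (LinearMap.proj i).smulRight (b i)
  have hφ : ∀ w, φ w = ∑ i, w i • b i := fun w => by
    simp only [φ, LinearMap.sum_apply, LinearMap.smulRight_apply, LinearMap.proj_apply]
  have hφsingle : ∀ i, φ (Pi.single i 1) = b i := fun i => by
    rw [hφ, Finset.sum_eq_single i]
    · rw [Pi.single_eq_same, one_smul]
    · intro i' _ hi'; rw [Pi.single_eq_of_ne hi', zero_smul]
    · intro hi; exact absurd (Finset.mem_univ i) hi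
  refine ⟨N, fun i => (ε i).1.2, φ, ?_, ?_⟩
  · exact isDegZero_of_isHomog e _ φ fun i => (hφsingle i).symm ▸ hbhom i
  · apply le_antisymm
    · rintro _ ⟨w, rfl⟩
      rw [hφ]
      exact Submodule.sum_mem _ fun i _ => Submodule.smul_mem _ _ (hbK i)
    · rw [← ht, Submodule.span_le]
      intro g hg
      rw [SetLike.mem_coe, ← sum_projDeg e g]
      refine Submodule.sum_mem _ fun dd hdd => ?_
      have hmem : (g, dd) ∈ H := Finset.mem_biUnion.mpr ⟨g, hg, Finset.mem_image.mpr ⟨dd, hdd, rfl⟩⟩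
      refine ⟨Pi.single (ε.symm ⟨(g, dd), hmem⟩) 1, ?_⟩
      rw [hφsingle]
      change projDeg e (ε (ε.symm ⟨(g, dd), hmem⟩)).1.2 (ε (ε.symm ⟨(g, dd), hmem⟩)).1.1 = _
      rw [Equiv.apply_symm_apply]

/-! ### The Laurent extension of a `P`-linear map of free modules -/

variable [Fintype J'] [DecidableEq J'] (φ : (J' → P A r) →ₗ[P A r] (J → P A r))

/-- The `L`-linear extension `φ_L : L^{n'} → L^n` of a `P`-linear map `φ : P^{n'} → P^n`
(`φ_L(w) = Σ_h w_h · ι(φ(e_h))`), as an `A`-linear map. [folklore] -/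
def extL : (J' → L A r) →ₗ[A] (J → L A r) :=
  ∑ h : J', (LinearMap.proj h : (J' → L A r) →ₗ[A] L A r).smulRight (ιK A r J (φ (Pi.single h 1)))

/-- `φ_L` unfolded. [folklore] -/
theorem extL_apply (w : J' → L A r) : extL φ w = ∑ h, w h • ιK A r J (φ (Pi.single h 1)) := by
  simp only [extL, LinearMap.sum_apply, LinearMap.smulRight_apply, LinearMap.proj_apply]

/-- `φ_L` is `L`-linear. [folklore] -/
theorem extL_smul (l : L A r) (w : J' → L A r) : extL φ (l • w) = l • extL φ w := by
  rw [extL_apply, extL_apply, Finset.smul_sum]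
  refine Finset.sum_congr rfl fun h _ => ?_
  rw [Pi.smul_apply, smul_eq_mul, mul_smul]

/-- **`φ_L` extends `φ`**: `φ_L ∘ ι = ι ∘ φ`. [folklore] -/
theorem extL_ιK (u : J' → P A r) : extL φ (ιK A r J' u) = ιK A r J (φ u) := by
  have hu : u = ∑ h, u h • (Pi.single h 1 : J' → P A r) := by
    conv_lhs => rw [← Finset.univ_sum_single u]
    refine Finset.sum_congr rfl fun h _ => ?_
    rw [← Pi.single_smul', smul_eq_mul, mul_one]
  rw [extL_apply]
  conv_rhs => rw [hu, map_sum, map_sum]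
  refine Finset.sum_congr rfl fun h _ => ?_
  rw [map_smul, ιK_smul, ιK_apply]

variable {e e' φ}

/-- A degree-zero `φ` has a degree-zero extension: `φ_L(𝕂'_{dd}) ⊆ 𝕂_{dd}`. [folklore] -/
theorem extL_mem_Kdeg (hφ : IsDegZero e e' φ) {dd : ℤ} {w : J' → L A r} (hw : w ∈ Kdeg A r e' dd) :
    extL φ w ∈ Kdeg A r e dd := by
  rw [extL_apply]
  refine Submodule.sum_mem _ fun h _ => ?_
  have hb : ιK A r J (φ (Pi.single h 1)) ∈ Kdeg A r e (e' h) := by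
    rw [← projDeg_eq_self_iff, ← hφ, (isHomog_single e' h)]
  rw [mem_Kdeg] at hw hb ⊢
  intro j
  rw [Pi.smul_apply, smul_eq_mul, show dd - e j = (dd - e' h) + (e' h - e j) by ring]
  exact mul_mem_Ldeg (hw h) (hb j)

/-- `φ_L` maps the localized pieces of `P^{n'}` into those of the image of `φ`. [folklore] -/
theorem extL_mem_loc (s : Finset (Fin (r + 1))) {w : J' → L A r}
    (hw : w ∈ loc (⊤ : Submodule (P A r) (J' → P A r)) s) : extL φ w ∈ loc (LinearMap.range φ) s := by
  obtain ⟨N, u, -, hu⟩ := hw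
  refine ⟨N, φ u, LinearMap.mem_range_self φ u, ?_⟩
  rw [← extL_smul, hu, extL_ιK]

/-- **`φ_L` maps `(P^{n'}_s)_{dd}` onto `(K_s)_{dd}`, `K = im φ`** (exactness of localization,
made explicit: lift `x_s^N v = ι(φ u)` by the homogeneous component of `u`). [folklore] -/
theorem extL_surjOn (hφ : IsDegZero e e' φ) (s : Finset (Fin (r + 1))) (dd : ℤ) {v : J → L A r}
    (hv : v ∈ locDeg e (LinearMap.range φ) s dd) :
    ∃ w ∈ locDeg e' (⊤ : Submodule (P A r) (J' → P A r)) s dd, extL φ w = v := by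
  obtain ⟨⟨N, k, ⟨u, rfl⟩, hk⟩, hvdeg⟩ := hv
  -- replace `u` by its homogeneous component of degree `D = dd + N #s`
  set D := dd + N * s.card with hD
  have hv' : xs A s N • v ∈ Kdeg A r e D := xs_smul_mem_Kdeg e hvdeg s N
  set u₀ := projDeg e' D u with hu₀
  have hφu₀ : ιK A r J (φ u₀) = xs A s N • v := by
    rw [hu₀, hφ, ιK_projDeg, ← hk, KfilterDeg_of_mem e hv']
  refine ⟨xs A s (-N) • ιK A r J' u₀, ⟨⟨N, u₀, Submodule.mem_top, ?_⟩, ?_⟩, ?_⟩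
  · rw [smul_smul, xs_mul_xs_neg, one_smul]
  · have h1 : ιK A r J' u₀ ∈ Kdeg A r e' D := by
      rw [← projDeg_eq_self_iff, hu₀]
      apply ιK_injective
      rw [ιK_projDeg, ιK_projDeg]
      exact KfilterDeg_of_mem e' (KfilterDeg_mem_Kdeg e' _ _)
    have := xs_smul_mem_Kdeg e' h1 s (-N)
    rwa [hD, show dd + N * s.card + -N * s.card = dd by ring] at this
  · rw [extL_smul, extL_ιK, hφu₀, smul_smul, xs_neg_mul_xs, one_smul]

/-- **The kernel of `φ_L` on `(P^{n'}_s)_{dd}` is `((ker φ)_s)_{dd}`.** [folklore] -/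
theorem mem_locDeg_ker_of_extL_eq_zero (s : Finset (Fin (r + 1))) (dd : ℤ) {w : J' → L A r}
    (hw : w ∈ locDeg e' (⊤ : Submodule (P A r) (J' → P A r)) s dd) (h0 : extL φ w = 0) :
    w ∈ locDeg e' (LinearMap.ker φ) s dd := by
  obtain ⟨⟨N, u, -, hu⟩, hwdeg⟩ := hw
  refine ⟨⟨N, u, ?_, hu⟩, hwdeg⟩
  rw [LinearMap.mem_ker]
  apply ιK_injective
  rw [← extL_ιK, ← hu, extL_smul, h0, smul_zero, map_zero]

/-- `φ_L` kills the localized pieces of `ker φ`. [folklore] -/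
theorem extL_eq_zero_of_mem_loc_ker (s : Finset (Fin (r + 1))) {w : J' → L A r}
    (hw : w ∈ loc (LinearMap.ker φ) s) : extL φ w = 0 := by
  obtain ⟨N, u, hu, hw⟩ := hw
  rw [LinearMap.mem_ker] at hu
  have : xs A s N • extL φ w = 0 := by rw [← extL_smul, hw, extL_ιK, hu, map_zero]
  calc extL φ w = xs A s (-N) • (xs A s N • extL φ w) := by rw [smul_smul, xs_neg_mul_xs, one_smul]
    _ = 0 := by rw [this, smul_zero]

/-- The localized pieces are monotone in the submodule. [folklore] -/
theorem loc_mono_left {K K' : Submodule (P A r) (J → P A r)} (hKK' : K ≤ K') (s : Finset (Fin (r + 1))) :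
    loc K s ≤ loc K' s := by
  rintro v ⟨N, k, hk, hv⟩
  exact ⟨N, k, hKK' hk, hv⟩

variable (e e' φ)

/-- The short complex of Čech complexes `Č_{dd}(ker φ) → Č_{dd}(P^{n'}) → Č_{dd}(im φ)`
(inclusion, then `φ_L`) attached to a degree-zero `P`-linear `φ : P^{n'} → P^n`. [folklore] -/
def presentationSC (hφ : IsDegZero e e' φ) (dd : ℤ) : ShortComplex (CochainComplex (ModuleCat.{u} A) ℤ) :=
  familySC (E := fun s => locDeg e' (LinearMap.ker φ) s dd)
    (F := fun s => locDeg e' (⊤ : Submodule (P A r) (J' → P A r)) s dd)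
    (G := fun s => locDeg e (LinearMap.range φ) s dd)
    (extL φ) (fun s _ hx => ⟨extL_mem_loc s hx.1, extL_mem_Kdeg hφ hx.2⟩)
    (locDeg_mono e' _ dd) (locDeg_mono e _ dd) (locDeg_mono e' _ dd)
    LinearMap.id (fun s _ hx => ⟨loc_mono_left le_top s hx.1, hx.2⟩)
    (fun s _ hx => extL_eq_zero_of_mem_loc_ker s hx.1)

/-- The three complexes of `presentationSC` are the Čech complexes of `ker φ`, `P^{n'}`, `im φ`.
[folklore] -/
theorem presentationSC_X₁ (hφ : IsDegZero e e' φ) (dd : ℤ) :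
    (presentationSC e e' φ hφ dd).X₁ = cech e' (LinearMap.ker φ) dd := rfl

/-- See `presentationSC_X₁`. [folklore] -/
theorem presentationSC_X₂ (hφ : IsDegZero e e' φ) (dd : ℤ) :
    (presentationSC e e' φ hφ dd).X₂ = cech e' (⊤ : Submodule (P A r) (J' → P A r)) dd := rfl

/-- See `presentationSC_X₁`. [folklore] -/
theorem presentationSC_X₃ (hφ : IsDegZero e e' φ) (dd : ℤ) :
    (presentationSC e e' φ hφ dd).X₃ = cech e (LinearMap.range φ) dd := rfl

/-- **The short exact sequence of Čech complexes of a graded presentation**: for a degree-zero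
`P`-linear `φ : P^{n'} → P^n`,
`0 → Č_{dd}(ker φ) → Č_{dd}(P^{n'}) → Č_{dd}(im φ) → 0` is a short exact sequence of cochain
complexes of `A`-modules (the maps being the inclusion and `φ_L`). This is the exactness of the
localizations `M ↦ (M_{x_s})_{dd}` on `0 → ker φ → P^{n'} → im φ → 0`. [folklore] -/
theorem shortExact_presentationSC (hφ : IsDegZero e e' φ) (dd : ℤ) :
    (presentationSC e e' φ hφ dd).ShortExact :=
  shortExact_familySC (extL φ) _ (locDeg_mono e' _ dd) (locDeg_mono e _ dd) (locDeg_mono e' _ dd)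
    LinearMap.id _ (fun _ _ _ h => h) (fun s _ hy => extL_surjOn hφ s dd hy)
    (fun s _ hx => extL_eq_zero_of_mem_loc_ker s hx.1)
    (fun s x hx h0 => ⟨x, mem_locDeg_ker_of_extL_eq_zero s dd hx h0, rfl⟩)

end LaurentCech

end Literature.Algebra.Homology
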